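import Summits.RiemannHypothesis.RiemannHypothesis.Theses.RuelleBand
import Summits.RiemannHypothesis.RiemannHypothesis.Theorems.ExactFirstBand.Negative.Reformulations
import Summits.RiemannHypothesis.RiemannHypothesis.Theorems.RuelleBandExactFirstBandStubEvenSymTranslate
import Summits.RiemannHypothesis.RiemannHypothesis.Theorems.RuelleBandExactFirstBandStubEvenBumpCriterion
import Literature.NumberTheory.LFunctions.WeilExplicitFormulaProofs
import Literature.NumberTheory.LFunctions.WeilExplicitProofs
import HarnessLib.Audit

/-!
# Line `SketchIdeator1` (even Weil sector): RH ⟺ Weil's quadratic form is non-negative on symmetric pairs of bumps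

Crux `RuelleBand.ExactFirstBand` (stmt-RiemannHypothesis-2061).  The sharpest PINNED form of the line's criterion: the Riemann
hypothesis holds if and only if `Re W(h ⋆ h̃) ≥ 0` for every test function of the shape
`h(t) = (b(t - x) + b(t + x))/2`, `b : ContDiffBump 0` a Mathlib bump function at `0`, `x : ℝ` (a symmetric pair of bumps).
`←` is the landed `stub_evenBumpCriterion` (these are the only test functions the even-sector converse ever uses) and
`Negative.exactFirstBand_iff_riemannHypothesis`; `→` is Weil positivity under RH (`WeilPositivity.of_riemannHypothesis` with the
PROVED explicit formula) applied to `h`, which is a test function (`isWeilTest_bump` + `stub_evenSymTranslate`).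
-/

noncomputable section

open Complex

namespace Summit.RiemannHypothesis.RiemannHypothesis.Theorems.RuelleBandExactFirstBand

open Summit.RiemannHypothesis.RiemannHypothesis.Theses.RuelleBand
open Literature.NumberTheory.LFunctions

/-- **Bump-pair form of the even-sector criterion (X-form).**  Weil's quadratic form is non-negative on every symmetric pair of
bumps `(b(·-x)+b(·+x))/2` iff every zero of `ζ` in the open critical strip lies on the critical line or the real axis.
[folklore] -/
theorem stub_evenBumpCriterion_iff :
    (∀ (b : ContDiffBump (0 : ℝ)) (x : ℝ),
      0 ≤ (weilQuadratic (fun t : ℝ => (((b (t - x) : ℝ) : ℂ) + ((b (t + x) : ℝ) : ℂ)) / 2)).re) ↔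
    (∀ s : ℂ, riemannZeta s = 0 → 0 < s.re → s.re < 1 → s.re = 1 / 2 ∨ s.im = 0) := by
  refine ⟨stub_evenBumpCriterion, fun hX b x => ?_⟩
  have hRH : RiemannHypothesis :=
    Summit.RiemannHypothesis.Cruxes.ExactFirstBand.Negative.exactFirstBand_iff_riemannHypothesis.mp hX
  have hh : IsWeilTest (fun t : ℝ => (((b (t - x) : ℝ) : ℂ) + ((b (t + x) : ℝ) : ℂ)) / 2) :=
    (stub_evenSymTranslate (fun t : ℝ => ((b t : ℝ) : ℂ)) (isWeilTest_bump b) x).1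
  exact WeilPositivity.of_riemannHypothesis explicit_formula_holds hRH _ hh

/-- **RH ⟺ Weil positivity on symmetric pairs of bumps.**  The Riemann hypothesis holds iff `Re W(h ⋆ h̃) ≥ 0` for every
`h(t) = (b(t-x) + b(t+x))/2` with `b : ContDiffBump 0` and `x : ℝ` — a two-parameter (profile, shift) family of explicit even,
real, non-negative test functions.  Sharpening of Weil's criterion `weil_criterion_holds` (all smooth compactly supported
tests) and of `riemannHypothesis_iff_evenWeilPositivity` (even real tests). [folklore] -/
theorem riemannHypothesis_iff_bumpPairWeilPositivity :
    RiemannHypothesis ↔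
      ∀ (b : ContDiffBump (0 : ℝ)) (x : ℝ),
        0 ≤ (weilQuadratic (fun t : ℝ => (((b (t - x) : ℝ) : ℂ) + ((b (t + x) : ℝ) : ℂ)) / 2)).re := by
  rw [← Summit.RiemannHypothesis.Cruxes.ExactFirstBand.Negative.exactFirstBand_iff_riemannHypothesis]
  exact stub_evenBumpCriterion_iff.symm

end Summit.RiemannHypothesis.RiemannHypothesis.Theorems.RuelleBandExactFirstBand

end
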